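import Summits.NavierStokesRegularity.NavierStokesRegularity.Theorems.ApexLocalisation.Negative.BridgeTargets
import Literature.Analysis.FluidPDE.LocalTypeIReverseSuitable

/-!
# `ApexLocalisation` (crux stmt-NavierStokesRegularity-11719): the PICKED line
# `decaying-ancient-bridge` — (L)-vacuity of its bet and of its ⇐ transfer
# — negative-side support (cdisprove seat, gen 3, `-- Targets`, companion of `Negative/BridgeTargets.lean`)

A non-trivial member of the line's class 𝒜(C,B) (`InBridgeClass`, `Negative/BridgeTargets.lean`)
carries suitable-weak data with `𝐈 < ⊤` and is not a.e. zero (`not_ae_eq_zero_of_continuousOn_slab`),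
so by the blow-down of Albritton–Barker Thm 1.1 (reverse direction WITHOUT mildness — Literature
`localTypeISingularityExists_of_suitable_nontrivial'`, `LocalTypeIReverseSuitable.lean`) it yields
a Type-I singularity (`localTypeISingularityExists_of_inBridgeClass_nontrivial`); so does the
antecedent of `stub_apexOfDecaying` (`localTypeISingularityExists_of_decayingAntecedent`). Hence in
the (L)-world 𝒜(C,B) = {0} pointwise on the slab (`inBridgeClass_eq_zero_of_not_localTypeI`), and THE
BET `stub_hullSelection` and the ⇐ TRANSFER `stub_apexOfDecaying` are THEOREMS under
`¬ LocalTypeISingularityExists` (`hullSelection_of_not_localTypeI`, `apexOfDecaying_of_not_localTypeI`,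
exact shapes of the lead's stubs): none is refutable short of a Type-I blow-up — like the crux
(`Negative/LogicAndLoadBearing`, `Negative/LinesVacuity`). All sorry-free.

## References

* D. Albritton, T. Barker, J. Math. Fluid Mech. 21 (2019) = arXiv:1811.00502, Thm 1.1, §3. [AlbrittonBarker2019]
* G. Koch, N. Nadirashvili, G. Seregin, V. Šverák, Acta Math. 203 (2009), §6. [KNSS2009]
-/

noncomputable section

open MeasureTheory TopologicalSpace Set Function Filter Topology Metric
open scoped InnerProductSpace RealInnerProductSpace ENNReal NNReal
open Literature.Analysis Literature.Analysis.FluidPDE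
open Summit.NavierStokesRegularity.NavierStokesRegularity.Theses

set_option linter.dupNamespace false

namespace Summit.NavierStokesRegularity.NavierStokesRegularity.Theorems.ApexLocalisation.Negative

/-- Physical space. -/
local notation "ℝ³" => EuclideanSpace ℝ (Fin 3)

/-- The open backward slab `(-∞,0) × ℝ³` (time first), as in the route file. -/
local notation "𝕊" => Literature.Analysis.FluidPDE.slab (EuclideanSpace ℝ (Fin 3)) (Set.Iio (0 : ℝ)) isOpen_Iio

/-! ## (L)-vacuity: non-trivial members of 𝒜(C,B), and the ⇐ transfer's antecedent, are Type-I
singularities -/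

/-- A field continuous on the open slab which does not vanish at some point of the slab is not
a.e. zero there (verbatim the lead's glue `not_ae_eq_zero_of_continuousOn`). -/
theorem not_ae_eq_zero_of_continuousOn_slab {N : ℝ → ℝ³ → ℝ³}
    (hcont : ContinuousOn (uncurry N) (Iio (0 : ℝ) ×ˢ univ)) {s : ℝ} (hs : s < 0) {y : ℝ³}
    (hy : N s y ≠ 0) :
    ¬ (uncurry N =ᵐ[volume.restrict (Iio (0 : ℝ) ×ˢ (univ : Set ℝ³))] 0) := by
  intro h
  have hSopen : IsOpen (Iio (0 : ℝ) ×ˢ (univ : Set ℝ³)) := isOpen_Iio.prod isOpen_univ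
  have hUopen : IsOpen ((Iio (0 : ℝ) ×ˢ (univ : Set ℝ³)) ∩ (uncurry N) ⁻¹' ({0}ᶜ)) :=
    hcont.isOpen_inter_preimage hSopen isOpen_compl_singleton
  have hmem : ((s, y) : ℝ × ℝ³) ∈ (Iio (0 : ℝ) ×ˢ (univ : Set ℝ³)) ∩ (uncurry N) ⁻¹' ({0}ᶜ) :=
    ⟨⟨hs, mem_univ _⟩, hy⟩
  have hpos : 0 < volume ((Iio (0 : ℝ) ×ˢ (univ : Set ℝ³)) ∩ (uncurry N) ⁻¹' ({0}ᶜ)) :=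
    hUopen.measure_pos volume ⟨(s, y), hmem⟩
  have hzero : volume.restrict (Iio (0 : ℝ) ×ˢ (univ : Set ℝ³)) ((uncurry N) ⁻¹' ({0}ᶜ)) = 0 := by
    have h' : ∀ᵐ z ∂(volume.restrict (Iio (0 : ℝ) ×ˢ (univ : Set ℝ³))), z ∉ (uncurry N) ⁻¹' ({0}ᶜ) := by
      filter_upwards [h] with z hz
      simp [hz]
    exact measure_eq_zero_iff_ae_notMem.2 h'
  rw [Measure.restrict_apply' hSopen.measurableSet, inter_comm] at hzero
  exact hpos.ne' hzero

/-- **A non-trivial member of 𝒜(C,B) is a Type-I singularity** (A–B Thm 1.1 reverse direction,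
mildness-free form, tools discharged): the bet `stub_hullSelection` and the ⇒ transfer
`stub_rateToAncient` produce / quantify over objects of the Type-I world only. -/
theorem localTypeISingularityExists_of_inBridgeClass_nontrivial {C B : ℝ} {M : ℝ → ℝ³ → ℝ³}
    (hM : InBridgeClass C B M) (hnt : ∃ s : ℝ, s < 0 ∧ ∃ y : ℝ³, M s y ≠ 0) :
    LocalTypeISingularityExists := by
  obtain ⟨hcont, -, -, -, -, q, H, hsws, hgrad, hI⟩ := hM
  obtain ⟨s, hs, y, hy⟩ := hnt
  exact localTypeISingularityExists_of_suitable_nontrivial' hsws hgrad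
    (not_ae_eq_zero_of_continuousOn_slab hcont hs hy) hI

/-- **The antecedent of `stub_apexOfDecaying` is a Type-I singularity** (decay not even needed). -/
theorem localTypeISingularityExists_of_decayingAntecedent
    (h : ∃ (C' : ℝ) (N : ℝ → ℝ³ → ℝ³) (q : ℝ → ℝ³ → ℝ) (H : ℝ → ℝ³ → ℝ³ →L[ℝ] ℝ³),
      IsSuitableWeakSolutionOn 𝕊 1 0 N q ∧ HasWeakSpatialGradientOn 𝕊 N H ∧
      typeIBound (Iio (0 : ℝ) ×ˢ univ) N q H < ⊤ ∧
      ¬ (uncurry N =ᵐ[volume.restrict (Iio (0 : ℝ) ×ˢ (univ : Set ℝ³))] 0) ∧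
      ∀ t : ℝ, t < 0 → ∀ x : ℝ³, ‖N t x‖ ≤ C' / (1 + ‖x‖ + Real.sqrt (-t))) :
    LocalTypeISingularityExists := by
  obtain ⟨-, N, q, H, hsws, hgrad, hI, hnt, -⟩ := h
  exact localTypeISingularityExists_of_suitable_nontrivial' hsws hgrad hnt hI

/-- **In the (L)-world 𝒜(C,B) is `{0}` pointwise on the slab**: granted "no Type-I singular point",
every member vanishes identically for `t < 0`; the bet, the hull closure for non-trivial members
and both transfers then hold vacuously — irrefutable short of a Type-I blow-up. -/
theorem inBridgeClass_eq_zero_of_not_localTypeI (hno : ¬ LocalTypeISingularityExists) {C B : ℝ}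
    {M : ℝ → ℝ³ → ℝ³} (hM : InBridgeClass C B M) : ∀ s < 0, ∀ y : ℝ³, M s y = 0 := by
  intro s hs y
  by_contra hy
  exact hno (localTypeISingularityExists_of_inBridgeClass_nontrivial hM ⟨s, hs, y, hy⟩)


/-- **Under "no Type-I singular point" THE BET holds outright** (vacuously): the exact statement of
the lead's `stub_hullSelection` (radiation bound granted ↦ ignored; class 𝒜(C,B) inlined verbatim). -/
theorem hullSelection_of_not_localTypeI (hno : ¬ LocalTypeISingularityExists)
    (RB : Prop) (_ : RB) :
    ∀ (C B : ℝ) (M : ℝ → ℝ³ → ℝ³), InBridgeClass C B M →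
      (∃ s : ℝ, s < 0 ∧ ∃ y : ℝ³, M s y ≠ 0) →
      ∃ (xk : ℕ → ℝ³) (tk : ℕ → ℝ) (lk : ℕ → ℝ) (N : ℝ → ℝ³ → ℝ³),
        (∀ k, tk k ≤ 0 ∧ 0 < lk k ∧ lk k ≤ 1) ∧
        (∀ t < 0, TendstoLocallyUniformly
          (fun k (y : ℝ³) => lk k • M (tk k + lk k ^ 2 * t) (xk k + lk k • y)) (N t) atTop) ∧
        ContinuousOn (uncurry N) (Iio (0 : ℝ) ×ˢ univ) ∧
        (∃ s : ℝ, s < 0 ∧ ∃ y : ℝ³, N s y ≠ 0) ∧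
        ∃ K : ℝ, ∀ s < 0, ∀ y : ℝ³, ‖y‖ * ‖N s y‖ ≤ K :=
  fun _ _ _ hM hnt => absurd (localTypeISingularityExists_of_inBridgeClass_nontrivial hM hnt) hno

/-- **Under "no Type-I singular point" the ⇐ TRANSFER holds outright** (vacuously): the exact
shape of `stub_apexOfDecaying` (engine hypothesis ↦ ignored). -/
theorem apexOfDecaying_of_not_localTypeI (hno : ¬ LocalTypeISingularityExists)
    (Engine : Prop) (_ : Engine)
    (h : ∃ (C' : ℝ) (N : ℝ → ℝ³ → ℝ³) (q : ℝ → ℝ³ → ℝ) (H : ℝ → ℝ³ → ℝ³ →L[ℝ] ℝ³),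
      IsSuitableWeakSolutionOn 𝕊 1 0 N q ∧ HasWeakSpatialGradientOn 𝕊 N H ∧
      typeIBound (Iio (0 : ℝ) ×ˢ univ) N q H < ⊤ ∧
      ¬ (uncurry N =ᵐ[volume.restrict (Iio (0 : ℝ) ×ˢ (univ : Set ℝ³))] 0) ∧
      ∀ t : ℝ, t < 0 → ∀ x : ℝ³, ‖N t x‖ ≤ C' / (1 + ‖x‖ + Real.sqrt (-t))) :
    ApexProfileExists :=
  absurd (localTypeISingularityExists_of_decayingAntecedent h) hno

end Summit.NavierStokesRegularity.NavierStokesRegularity.Theorems.ApexLocalisation.Negative
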